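import Literature.NumberTheory.Automorphic.ArchRankinSelbergConvergence
import Literature.NumberTheory.Automorphic.GLnCornerEmbedding
import HarnessLib

/-!
# Unitarity of the archimedean Kirillov model of a unitary generic representation, and Jacquet–Shalika's Kirillov bound (named facts)

Topic `NumberTheory/Automorphic`; namespace `Literature.NumberTheory.Automorphic`. Two named facts (no
proof in the tree), the second a proved consequence of the first: `JacquetShalika1981_archKirillovNorm_eq`
(the unitarity of the Kirillov model, `= c ‖v‖²`) and `JacquetShalika1981_archKirillovNorm_le`
(Jacquet–Shalika's printed Kirillov bound `≤ c ‖v‖²`, (3.16) Proposition — the only input the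
Rankin–Selberg application needs), with `JacquetShalika1981_archKirillovNorm_eq.le_fact : _eq → _le`.
Content of the first: for an irreducible unitary generic representation `π` of `GL_n(F)`, `F` archimedean,
`n ≥ 2`, the restriction of the (smooth) Whittaker functions to the mirabolic subgroup is square
integrable modulo `N_n`, and the resulting Hermitian form

  `(v, v') ↦ ∫_{N_{n-1} \ GL_{n-1}} W_v(diag(h, 1)) conj(W_{v'}(diag(h, 1))) dh`

is `GL_n(F)`-invariant, hence (Schur) a constant multiple of the Hilbert inner product ("unitarity of
the Kirillov model"). Printed, for the local components `Π_w` (archimedean or not) of a cuspidal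
automorphic representation and the Whittaker model of smooth vectors, in W. Zhang (2014), §3.1, (3.2)
(p. 554): "On `𝒲(Π_w, ψ_{E,w})` we have an invariant inner product defined by
`ϑ_w(W_w, W'_w) = ∫_{N_{n-1}(E_w) \ H_{n-1}(E_w)} W_w(h; 1) conj(W'_w(h; 1)) dh`. The integral `ϑ_w`
converges absolutely if `Π_w` is generic unitary." The original sources: Jacquet–Shalika (1981), §1
(non-archimedean, after Bernstein–Zelevinsky) and §3 (archimedean) for the convergence and this form;
the `G`-invariance of every continuous `P`-invariant form on the smooth vectors of an irreducible
unitary representation of `GL_n(ℝ)`, `GL_n(ℂ)` is Baruch (2003), Thm. 10.1 (Kirillov's conjecture),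
with the Whittaker inner product formula Thm. 10.3 / Cor. 10.4 there (Bernstein (1984) in the `p`-adic
case). Precisely, in Jacquet–Shalika (1981), §3 (`F = ℝ` or `ℂ`, `π` a unitary representation of
`G_r = GL_r(F)` on a Hilbert space `ℋ`, `ℋ^∞` its smooth vectors, `τ_r = Ind(P_r, N_r; θ_r)` the
irreducible unitary representation of the mirabolic `P_r` induced by the generic character `θ_r`):
Prop. (3.8), p. 522 — "(i) the restriction of `π` to `P_r` contains `τ_r`" is equivalent to
"(ii) there is a linear form `λ ≠ 0` on `ℋ_G^∞` [continuous] such that `λ(π(n)v) = θ(n)λ(v)`";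
(3.16), p. 542 — an irreducible unitary `π` is called *generic* when this holds, `W(g) = λ(π(g)v)`,
and "PROPOSITION. There is a positive constant `c` such that `∫_{N\P} |W|²(pg) d_r(p) ≤ c ‖W‖²` for
all `W ∈ 𝒲₀(π; ψ)` [`v` `K`-finite, `‖W‖ = ‖v‖`] and all `g ∈ G`" — the INEQUALITY, which is all
the Rankin–Selberg application uses (see `ArchRankinSelbergAbsConvergenceProofs`, §4); and Remark
(3.15)(1), p. 541 — "(iii) `π|P_r` is equivalent to `τ_r`", under which the form below is the pull-back
of the `L²(N_r\P_r)`-norm along a unitary equivalence, whence the EQUALITY with a constant `c` (for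
`r = 4`, `F = ℝ` loc. cit. only indicates "a similar but much more complicated argument"; the
equivalence `π|P_r ≅ τ_r` for every irreducible unitary generic `π` is Baruch's theorem).

Rendering in the tree's vocabulary (that of `ArchRankinSelbergConvergence` and of the named fact
`JacquetShalika1990_archRankinSelbergLIntegral_lt_top`, of which this is the essential input): `τ` is an
irreducible unitary strongly continuous representation of `G_∞ = GL_{m+1}(K_∞)` (`K_∞ = K ⊗_ℚ ℝ`, a finite
product of archimedean fields; as for that fact, the printed single-field statements apply to the
completed tensor product verbatim) on a Hilbert space `E`, `ℓ` a continuous `ψ_∞`-Whittaker functional on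
its Gårding space (`IsArchContWhittakerFunctional`), `W_v(g) = ℓ(τ(g) v)` for Gårding `v`, and the quotient
integral over `N_m \ GL_m` is written in Iwasawa coordinates `h = diag(u) k'`, `u ∈ (K_∞ˣ)^m`, `k' ∈ K_m`,
with the weight `δ_{B_m}(u)⁻¹ = archTorusWeight m K 0 u`, against Haar measures `μ'`, `μK'`; `diag(h, 1)` is
`GLn.cornerSucc`. The constant `c` depends on `τ, ℓ` and the measures (it is `0` iff `ℓ = 0`).

## References

* W. Zhang, *Automorphic period and the central value of Rankin–Selberg L-function*, J. Amer. Math.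
  Soc. 27 (2014), 541–612, §3.1, (3.2), p. 554 [Zhang2014].
* H. Jacquet, J. A. Shalika, *On Euler products and the classification of automorphic
  representations I*, Amer. J. Math. 103 (1981), 499–558, §1; §3: Prop. (3.7) p. 519, Prop. (3.8) p. 522,
  Remark (3.15)(1) p. 541, (3.16) Proposition p. 542 [JacquetShalikaAJM1981].
* E. M. Baruch, *A proof of Kirillov's conjecture*, Ann. of Math. 158 (2003), 207–252, Thm. 1.4,
  Thm. 10.1, Thm. 10.3, Cor. 10.4 [Baruch2003].
* J. N. Bernstein, *P-invariant distributions on GL(N) and the classification of unitary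
  representations of GL(N) (non-archimedean case)*, LNM 1041 (1984), 50–102.
* J. A. Shalika, *The multiplicity one theorem for GL_n*, Ann. of Math. 100 (1974), 171–193, Thm. 3.1
  [Shalika1974].
-/

noncomputable section

open MeasureTheory Measure NumberField NumberField.mixedEmbedding IsDedekindDomain Set
open scoped MatrixGroups ENNReal NNReal Classical

namespace Literature.NumberTheory.Automorphic

/-- **Unitarity of the archimedean Kirillov model (Jacquet–Shalika; Bernstein, Baruch).** For
`m ≥ 1`, an irreducible unitary strongly continuous representation `τ` of `GL_{m+1}(K_∞)` on a Hilbert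
space, a continuous `ψ_∞`-Whittaker functional `ℓ` on its Gårding space and Haar measures `μ'` on
`(K_∞ˣ)^m`, `μK'` on `K_m`, there is a finite constant `c` with
`∫ |ℓ(τ(diag(diag(u) k', 1)) v)|² δ_{B_m}(u)⁻¹ d(μ' × μK')(u, k') = c ‖v‖²` for every Gårding vector `v`
(the Whittaker functions restricted to the mirabolic are square integrable modulo `N`, and the resulting
`P`-invariant Hermitian form on the smooth vectors is `G`-invariant, hence a multiple of the inner
product, by Schur's lemma). [cite: Zhang2014, §3.1, (3.2), p. 554]
[cite: JacquetShalikaAJM1981, (3.16) Proposition p. 542 (the inequality `≤ c ‖W‖²`, all `g`), Remark (3.15)(1) p. 541 and Prop. (3.8) p. 522]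
[cite: Baruch2003, Thm. 10.1 and Cor. 10.4] -/
def JacquetShalika1981_archKirillovNorm_eq (m : ℕ) (K : Type) [Field K] [NumberField K] : Prop :=
  1 ≤ m → ∀ (hcpt : isCompact_glFiniteIntegralLevel (m + 1) K) (E : Type) [NormedAddCommGroup E]
    [InnerProductSpace ℂ E] [CompleteSpace E]
    (τ : ContRepresentation ℂ (AutomorphyDatum.gl (m + 1) K hcpt).arch.carrier E) (hτ : τ.IsStronglyContinuous)
    (_ : τ.IsUnitary) (_ : τ.IsTopIrreducible)
    (ℓ : archGardingSpace hcpt τ →ₗ[ℂ] ℂ) (_ : IsArchContWhittakerFunctional hcpt τ hτ ℓ)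
    [MeasurableSpace (GL (Fin m) (mixedSpace K))] [BorelSpace (GL (Fin m) (mixedSpace K))]
    [MeasurableSpace ((mixedSpace K)ˣ)] [BorelSpace ((mixedSpace K)ˣ)]
    (μ' : Measure (Fin m → (mixedSpace K)ˣ)) (_ : IsHaarMeasure μ')
    (μK' : Measure ↥(Kinf m K)) (_ : IsHaarMeasure μK'),
    ∃ c : ℝ≥0∞, c ≠ ⊤ ∧ ∀ v : archGardingSpace hcpt τ,
      ∫⁻ p : (Fin m → (mixedSpace K)ˣ) × ↥(Kinf m K),
        ‖ℓ ⟨τ (toArch hcpt (GLn.cornerSucc (mixedSpace K)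
            (glDiagonal m (mixedSpace K) p.1 * (p.2 : GL (Fin m) (mixedSpace K))))) (v : E),
          apply_mem_archGardingSpace hτ _ v.2⟩‖ₑ ^ 2 *
          ENNReal.ofReal (archTorusWeight m K 0 p.1) ∂(μ'.prod μK') = c * ‖(v : E)‖ₑ ^ 2

/-- **Jacquet–Shalika's Kirillov bound (Jacquet–Shalika I, (3.16) Proposition, p. 542) — the
inequality.** Printed: for `π` an irreducible unitary *generic* representation of `G = GL_r(F)`,
`F = ℝ` or `ℂ` (i.e. (3.16): there is a continuous linear form `λ ≠ 0` on the smooth vectors with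
`λ(π(n)v) = θ(n)λ(v)`), and `W(g) = λ(π(g)v)`: *"Notations being as above, there is a positive constant
`c` such that `∫_{N\P} |W|²(pg) d_r(p) ≤ c ‖W‖²` for all `W ∈ 𝒲₀(π; ψ)` and all `g ∈ G`"* (`𝒲₀`: `v`
`K`-finite, `‖W‖ := ‖v‖`; `N\P = N_r\P_r ≅ N_{r-1}\G_{r-1}`, `d_r p` right invariant). The proof
(Prop. (3.8) (ii) ⇒ (i), pp. 522–541: `π|P_r` contains `τ_r = Ind(P_r, N_r; θ_r)`; then "exactly as
in Proposition (1.5)", i.e. as on p. 506: for the orthogonal projection `A` onto a copy of `τ_r` the form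
`v ↦ A(v)(e)` is a Whittaker functional with `p ↦ A(π(p)v)(e) = (A v)(p)`, `‖A v‖_{L²(N\P)} ≤ ‖v‖`, and
the given `λ` is a multiple of it by the uniqueness of Whittaker functionals — used in Remark (3.15)(1),
"the uniqueness of `λ`"; for irreducible unitary representations and functionals continuous on the
smooth vectors this is Shalika (1974), Thm. 3.1) gives the bound for every smooth vector
`v ∈ ℋ_P^∞ ⊇ ℋ_G^∞`, in particular for all Gårding vectors and all their translates — the form stated
here, in the vocabulary of `JacquetShalika1981_archKirillovNorm_eq` above (same binders; `K_∞` a finite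
product of archimedean fields, to whose irreducible unitary representations — completed tensor products
— the single-field statement and proof apply verbatim; for `ℓ = 0` take `c = 0`). This INEQUALITY is
all that the Rankin–Selberg application consumes (`ArchRankinSelbergAbsConvergenceProofs`, §4:
`JacquetShalika1981_partialPairL_pole_of_eq_conj_of_archKirillovNorm_le`); the equality `_eq` above is
this bound together with `π|P_r ≅ τ_r` (Remark (3.15)(1); Baruch (2003)), and implies it
(`JacquetShalika1981_archKirillovNorm_eq.le_fact` below).
-- TODO(general form): the half `(i) ⇒ (ii)` of Prop. (3.8) and the equivalence `π|P_r ≅ τ_r` are not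
-- restated here; `K`-finiteness is not singled out (the tree has no `K`-finite vectors for `τ`).
[cite: JacquetShalikaAJM1981, (3.16) Proposition, p. 542, with Prop. (3.8) p. 522, Prop. (3.7) p. 519 and p. 506]
[cite: Shalika1974, Thm. 3.1] -/
def JacquetShalika1981_archKirillovNorm_le (m : ℕ) (K : Type) [Field K] [NumberField K] : Prop :=
  1 ≤ m → ∀ (hcpt : isCompact_glFiniteIntegralLevel (m + 1) K) (E : Type) [NormedAddCommGroup E]
    [InnerProductSpace ℂ E] [CompleteSpace E]
    (τ : ContRepresentation ℂ (AutomorphyDatum.gl (m + 1) K hcpt).arch.carrier E) (hτ : τ.IsStronglyContinuous)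
    (_ : τ.IsUnitary) (_ : τ.IsTopIrreducible)
    (ℓ : archGardingSpace hcpt τ →ₗ[ℂ] ℂ) (_ : IsArchContWhittakerFunctional hcpt τ hτ ℓ)
    [MeasurableSpace (GL (Fin m) (mixedSpace K))] [BorelSpace (GL (Fin m) (mixedSpace K))]
    [MeasurableSpace ((mixedSpace K)ˣ)] [BorelSpace ((mixedSpace K)ˣ)]
    (μ' : Measure (Fin m → (mixedSpace K)ˣ)) (_ : IsHaarMeasure μ')
    (μK' : Measure ↥(Kinf m K)) (_ : IsHaarMeasure μK'),
    ∃ c : ℝ≥0∞, c ≠ ⊤ ∧ ∀ v : archGardingSpace hcpt τ,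
      ∫⁻ p : (Fin m → (mixedSpace K)ˣ) × ↥(Kinf m K),
        ‖ℓ ⟨τ (toArch hcpt (GLn.cornerSucc (mixedSpace K)
            (glDiagonal m (mixedSpace K) p.1 * (p.2 : GL (Fin m) (mixedSpace K))))) (v : E),
          apply_mem_archGardingSpace hτ _ v.2⟩‖ₑ ^ 2 *
          ENNReal.ofReal (archTorusWeight m K 0 p.1) ∂(μ'.prod μK') ≤ c * ‖(v : E)‖ₑ ^ 2

/-- The unitarity of the Kirillov model (`= c ‖v‖²`) implies Jacquet–Shalika's Kirillov bound
(`≤ c ‖v‖²`). [cite: JacquetShalikaAJM1981, (3.16) Proposition, p. 542] -/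
theorem JacquetShalika1981_archKirillovNorm_eq.le_fact {m : ℕ} {K : Type} [Field K] [NumberField K]
    (h : JacquetShalika1981_archKirillovNorm_eq m K) : JacquetShalika1981_archKirillovNorm_le m K := by
  intro hm hcpt E _ _ _ τ hτ hτu hτi ℓ hℓ _ _ _ _ μ' hμ' μK' hμK'
  obtain ⟨c, hc, hv⟩ := h hm hcpt E τ hτ hτu hτi ℓ hℓ μ' hμ' μK' hμK'
  exact ⟨c, hc, fun v => (hv v).le⟩

/-- The Kirillov bound holds vacuously in rank `m + 1 = 1` (`m = 0`: the hypothesis `1 ≤ m` fails),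
a sanity check of the binder convention shared with `JacquetShalika1981_archKirillovNorm_eq`. [folklore] -/
theorem JacquetShalika1981_archKirillovNorm_le_zero (K : Type) [Field K] [NumberField K] :
    JacquetShalika1981_archKirillovNorm_le 0 K :=
  fun h => absurd h (Nat.not_succ_le_zero 0)

end Literature.NumberTheory.Automorphic
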